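import Literature.NumberTheory.LFunctions.RayClassLSeriesConvexity
import Literature.NumberTheory.LFunctions.ClassGroupLFunctionZeroCount
import HarnessLib

/-!
# Zeros of Hecke `L`-series of primitive ray class characters in discs: Jensen's inequality, uniformly
# in the field and the modulus (Thorner–Zaman Lemma 2.5 / Lagarias–Odlyzko Lemma 5.4)

Topic `Literature/NumberTheory/LFunctions`; namespace `Literature.NumberTheory.LFunctions`.  Pure-proof
companion of `RayClassLSeriesConvexity.lean` (the uniform convexity bound) and the ray-class analogue of
`ClassGroupLFunctionZeroCount.lean` (conductor `1`).  Everything here is PROVED; no definition and no named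
fact is introduced.

For a primitive ray class character `χ mod 𝔪 ≠ 0` of sign type `p` of a number field `K` of degree `n`,
non-principal on the ideals prime to `𝔪`, and the (unique) entire continuation `L` of `L(χ, ·)`:

* `exp_neg_finrank_div_le_norm_rayClassLSeries` — **`|L(χ, s)| ≥ e^{−n/(σ−1)}`** for `σ = Re s > 1`
  (Euler product: `|L(χ, s)| · L_𝔪(1, σ) ≥ 1` termwise, and `L_𝔪(1, σ) ≤ ζ_K(σ) ≤ e^{n/(σ−1)}`);
* (private) two entire continuations of `L(χ, ·)` coincide (identity theorem);
* `finsum_divisor_continuation_le` — **Jensen**: for `0 < r < 2` the number of zeros of `L` in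
  `|s − (2 + it)| ≤ r`, with multiplicity, is at most `M/log(2/r)` with
  `M = log(|d_K| 𝔑𝔪) + 3n + n log(|t| + 7)` — [ThornerZaman2019, Lemma 2.5] ("`#{ρ : |γ − t| ≤ 1} ≪
  log(D_K N𝔣_χ) + n_K log(|t| + 3)`", quoted from [LagariasOdlyzko1977, Lemma 5.4]) in disc form with
  absolute constants; `sum_divisor_continuation_le` — at most `8M` zeros in the disc of radius `7/4`.

## References

* J. Thorner, A. Zaman, *A unified and improved Chebotarev density theorem*, Algebra Number Theory 13
  (2019), Lemma 2.5. [ThornerZaman2019]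
* J. C. Lagarias, A. M. Odlyzko, *Effective versions of the Chebotarev density theorem*, in: Algebraic
  Number Fields (Durham 1975), Academic Press 1977, Lemma 5.4. [LagariasOdlyzko1977]
-/

noncomputable section

open Complex NumberField NumberField.InfinitePlace NumberField.Units IsDedekindDomain Filter Topology Set Metric
  MeromorphicOn
open scoped NumberField nonZeroDivisors
open scoped Classical

namespace Literature.NumberTheory.LFunctions

variable {K : Type*} [Field K] [NumberField K]
variable {𝔪 : Ideal (𝓞 K)} {ψ : HeightOneSpectrum (𝓞 K) → ℂ} {p : Finset {w : InfinitePlace K // IsReal w}}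

/-! ### The uniform lower bound `|L(χ, s)| ≥ e^{−n/(σ−1)}` on `σ > 1` -/

/-- The norm of a convergent infinite product whose factors have norm `≥ 1` is `≥ 1`. [folklore] -/
private theorem one_le_norm_of_hasProd {ι : Type*} {f : ι → ℂ} {a : ℂ} (h : HasProd f a)
    (hf : ∀ i, 1 ≤ ‖f i‖) : 1 ≤ ‖a‖ := by
  have ht : Tendsto (fun F : Finset ι ↦ ‖∏ i ∈ F, f i‖) atTop (𝓝 ‖a‖) :=
    (continuous_norm.tendsto a).comp h
  refine ge_of_tendsto' ht fun F ↦ ?_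
  rw [norm_prod]
  calc (1 : ℝ) = ∏ _i ∈ F, (1 : ℝ) := Finset.prod_const_one.symm
    _ ≤ ∏ i ∈ F, ‖f i‖ := Finset.prod_le_prod (fun _ _ ↦ zero_le_one) fun i _ ↦ hf i

/-- **`|L(χ, s)| ≥ e^{−n_K/(σ−1)}`** for `σ = Re s > 1` and `|χ| ≤ 1`, uniformly in `K`, `𝔪`, `χ`: with
`L_𝔪(1, σ) = ∏_{𝔭 ∤ 𝔪}(1 − 𝔑𝔭^{−σ})⁻¹`, termwise `|(1 − χ(𝔭)𝔑𝔭^{−s})⁻¹| (1 − 𝔑𝔭^{−σ})⁻¹ ≥ 1`, so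
`|L(χ,s)| L_𝔪(1,σ) ≥ 1`, and `L_𝔪(1, σ) ≤ e^{n/(σ−1)}`. [cite: ThornerZaman2019, Lemma 2.5 (proof)] -/
theorem exp_neg_finrank_div_le_norm_rayClassLSeries (h𝔪 : 𝔪 ≠ ⊥)
    (hψ1 : ∀ v : HeightOneSpectrum (𝓞 K), ¬ 𝔪 ≤ v.asIdeal → ‖ψ v‖ ≤ 1) {s : ℂ} (hs : 1 < s.re) :
    Real.exp (-(Module.finrank ℚ K / (s.re - 1))) ≤ ‖rayClassLSeries 𝔪 ψ s‖ := by
  set ψ₀ : HeightOneSpectrum (𝓞 K) → ℂ := fun _ ↦ 1 with hψ₀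
  have hψ₀1 : ∀ v : HeightOneSpectrum (𝓞 K), ¬ 𝔪 ≤ v.asIdeal → ‖ψ₀ v‖ ≤ 1 := fun v _ ↦ by simp [hψ₀]
  have hσ : 1 < ((s.re : ℂ)).re := by simpa using hs
  have hP := (hasProd_rayClassLSeries h𝔪 hψ1 hs).mul (hasProd_rayClassLSeries h𝔪 hψ₀1 hσ)
  -- termwise `≥ 1`
  have hterm : ∀ v : {v : HeightOneSpectrum (𝓞 K) // ¬ 𝔪 ≤ v.asIdeal},
      1 ≤ ‖(1 - ψ v.1 * ((Ideal.absNorm v.1.asIdeal : ℕ) : ℂ) ^ (-s))⁻¹ *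
        (1 - ψ₀ v.1 * ((Ideal.absNorm v.1.asIdeal : ℕ) : ℂ) ^ (-((s.re : ℝ) : ℂ)))⁻¹‖ := by
    intro v
    have hNpos : 0 < Ideal.absNorm v.1.asIdeal := absNorm_heightOneSpectrum_pos v.1
    set x : ℝ := ((Ideal.absNorm v.1.asIdeal : ℕ) : ℝ) ^ (-s.re) with hx
    have hx0 : 0 < x := Real.rpow_pos_of_pos (by exact_mod_cast hNpos) _
    have hxhalf : x ≤ 1 / 2 := absNorm_rpow_neg_le_half v.1 hs.le
    have hzle : ‖ψ v.1 * ((Ideal.absNorm v.1.asIdeal : ℕ) : ℂ) ^ (-s)‖ ≤ x := by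
      rw [norm_mul, Complex.norm_natCast_cpow_of_pos hNpos, Complex.neg_re, ← hx]
      exact mul_le_of_le_one_left hx0.le (hψ1 v.1 v.2)
    have hx' : ψ₀ v.1 * ((Ideal.absNorm v.1.asIdeal : ℕ) : ℂ) ^ (-((s.re : ℝ) : ℂ)) = (x : ℂ) := by
      rw [hψ₀]; dsimp only
      rw [one_mul, hx, ← Complex.ofReal_natCast, ← Complex.ofReal_neg, ← Complex.ofReal_cpow (Nat.cast_nonneg _)]
    have hn1x : ‖(1 : ℂ) - (x : ℂ)‖ = 1 - x := by
      rw [← Complex.ofReal_one, ← Complex.ofReal_sub, Complex.norm_real, Real.norm_of_nonneg (by linarith)]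
    rw [hx', norm_mul, norm_inv, norm_inv, hn1x]
    have h1z : 0 < ‖(1 : ℂ) - ψ v.1 * ((Ideal.absNorm v.1.asIdeal : ℕ) : ℂ) ^ (-s)‖ := by
      have : ‖(1 : ℂ) - ψ v.1 * ((Ideal.absNorm v.1.asIdeal : ℕ) : ℂ) ^ (-s)‖ ≥ 1 - x := by
        have := norm_sub_norm_le (1 : ℂ) (ψ v.1 * ((Ideal.absNorm v.1.asIdeal : ℕ) : ℂ) ^ (-s))
        rw [norm_one] at this; linarith
      linarith
    have hub : ‖(1 : ℂ) - ψ v.1 * ((Ideal.absNorm v.1.asIdeal : ℕ) : ℂ) ^ (-s)‖ * (1 - x) ≤ 1 := by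
      have h1 : ‖(1 : ℂ) - ψ v.1 * ((Ideal.absNorm v.1.asIdeal : ℕ) : ℂ) ^ (-s)‖ ≤ 1 + x := by
        calc ‖(1 : ℂ) - ψ v.1 * ((Ideal.absNorm v.1.asIdeal : ℕ) : ℂ) ^ (-s)‖
            ≤ ‖(1 : ℂ)‖ + ‖ψ v.1 * ((Ideal.absNorm v.1.asIdeal : ℕ) : ℂ) ^ (-s)‖ := norm_sub_le _ _
          _ ≤ 1 + x := by rw [norm_one]; linarith
      calc ‖(1 : ℂ) - ψ v.1 * ((Ideal.absNorm v.1.asIdeal : ℕ) : ℂ) ^ (-s)‖ * (1 - x) ≤ (1 + x) * (1 - x) :=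
            mul_le_mul_of_nonneg_right h1 (by linarith)
        _ = 1 - x ^ 2 := by ring
        _ ≤ 1 := by nlinarith
    rw [← mul_inv, one_le_inv₀ (mul_pos h1z (by linarith))]
    exact hub
  have hge := one_le_norm_of_hasProd hP hterm
  rw [norm_mul] at hge
  -- `‖L_𝔪(1, σ)‖ ≤ e^{n/(σ−1)}`
  have h0 := norm_rayClassLSeries_le_exp h𝔪 hψ₀1 hσ
  rw [Complex.ofReal_re] at h0
  have hpos : 0 < ‖rayClassLSeries 𝔪 ψ₀ (s.re : ℂ)‖ := by
    by_contra hle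
    push Not at hle
    have : ‖rayClassLSeries 𝔪 ψ s‖ * ‖rayClassLSeries 𝔪 ψ₀ (s.re : ℂ)‖ ≤ 0 :=
      mul_nonpos_of_nonneg_of_nonpos (norm_nonneg _) hle
    linarith
  rw [Real.exp_neg]
  calc (Real.exp (Module.finrank ℚ K / (s.re - 1)))⁻¹ ≤ ‖rayClassLSeries 𝔪 ψ₀ (s.re : ℂ)‖⁻¹ :=
        inv_anti₀ hpos h0
    _ ≤ ‖rayClassLSeries 𝔪 ψ s‖ := by
        rw [inv_le_iff_one_le_mul₀ hpos]; exact hge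

/-! ### Uniqueness of the continuation and the value at `2 + it` -/

/-- **Two entire continuations of `L(χ, ·)` coincide** (identity theorem). [folklore] -/
private theorem continuation_unique {L L' : ℂ → ℂ} (hL : Differentiable ℂ L) (hL' : Differentiable ℂ L')
    (hLs : ∀ s : ℂ, 1 < s.re → L s = rayClassLSeries 𝔪 ψ s)
    (hL's : ∀ s : ℂ, 1 < s.re → L' s = rayClassLSeries 𝔪 ψ s) : L = L' := by
  have h := AnalyticOnNhd.eqOn_of_preconnected_of_eventuallyEq (𝕜 := ℂ)
    (hL.differentiableOn.analyticOnNhd isOpen_univ) (hL'.differentiableOn.analyticOnNhd isOpen_univ)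
    isPreconnected_univ (Set.mem_univ (2 : ℂ)) ?_
  · exact funext fun s ↦ h (Set.mem_univ s)
  · refine eventually_of_mem ((continuous_re.isOpen_preimage _ isOpen_Ioi).mem_nhds (by simp : 1 < (2 : ℂ).re))
      fun t (ht : 1 < t.re) ↦ ?_
    rw [hLs t ht, hL's t ht]

/-- `|L(2 + it)| ≥ e^{−n_K}` for any continuation `L`. [folklore] -/
private theorem exp_neg_finrank_le_norm_continuation_two_add (h𝔪 : 𝔪 ≠ ⊥) (hψ : IsRayClassCharacter 𝔪 ψ)
    {L : ℂ → ℂ} (hLs : ∀ s : ℂ, 1 < s.re → L s = rayClassLSeries 𝔪 ψ s) (t : ℝ) :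
    Real.exp (-(Module.finrank ℚ K : ℝ)) ≤ ‖L (2 + t * I)‖ := by
  have hre : (2 + t * I : ℂ).re = 2 := by simp
  have h2 : 1 < (2 + t * I : ℂ).re := by rw [hre]; norm_num
  rw [hLs _ h2]
  have h := exp_neg_finrank_div_le_norm_rayClassLSeries h𝔪 (fun v hv ↦ (hψ.norm_eq_one v hv).le) h2
  rwa [hre, show (2 : ℝ) - 1 = 1 by norm_num, div_one] at h

/-! ### Jensen's inequality -/

set_option maxHeartbeats 800000 in
/-- **Zeros of `L(χ, ·)` in a disc at height `t`, uniformly in `K` and `𝔪`** (Jensen's inequality;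
[ThornerZaman2019, Lemma 2.5] = [LO 1977, Lemma 5.4], disc form): for a primitive `χ mod 𝔪 ≠ 0` of sign type
`p`, non-principal on the ideals prime to `𝔪`, its entire continuation `L`, and `0 < r < 2`, the number of
zeros of `L` in `|s − (2 + it)| ≤ r` (with multiplicity, Mathlib's `divisor`) is at most
`(log(|d_K| 𝔑𝔪) + 3 n_K + n_K log(|t| + 7)) / log(2/r)`. [cite: ThornerZaman2019, Lemma 2.5] -/
theorem finsum_divisor_continuation_le (hψ : IsRayClassCharacter 𝔪 ψ) (hprim : IsPrimitive 𝔪 ψ)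
    (hp : IsSignType 𝔪 ψ p) (h𝔪 : 𝔪 ≠ ⊥)
    (hnt : ∃ v : HeightOneSpectrum (𝓞 K), ¬ 𝔪 ≤ v.asIdeal ∧ ψ v ≠ 1)
    {L : ℂ → ℂ} (hL : Differentiable ℂ L) (hLs : ∀ s : ℂ, 1 < s.re → L s = rayClassLSeries 𝔪 ψ s)
    (t : ℝ) {r : ℝ} (hr : 0 < r) (hr' : r < 2) :
    (∑ᶠ u, divisor L (closedBall (2 + t * I) r) u : ℝ) ≤
      (Real.log (|(discr K : ℝ)| * (Ideal.absNorm 𝔪 : ℝ)) + 3 * Module.finrank ℚ K +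
        Module.finrank ℚ K * Real.log (|t| + 7)) / Real.log (2 / r) := by
  obtain ⟨L₀, hL₀d, hL₀s, hL₀b⟩ := exists_continuation_norm_le_of_mem_closedBall hψ hprim hp h𝔪 hnt
  have hLL : L = L₀ := continuation_unique hL hL₀d hLs hL₀s
  subst hLL
  set n : ℕ := Module.finrank ℚ K with hn
  set c : ℂ := 2 + t * I with hc
  set A : ℝ := |(discr K : ℝ)| * (Ideal.absNorm 𝔪 : ℝ) with hA
  set B : ℝ := A * Real.exp (2 * n) * (|t| + 7) ^ n with hB
  have hA1 : 1 ≤ A := by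
    have h1 : (1 : ℝ) ≤ |(discr K : ℝ)| := by
      have := Int.one_le_abs (discr_ne_zero K)
      rw [← Int.cast_abs]; exact_mod_cast this
    have h2 : (1 : ℝ) ≤ (Ideal.absNorm 𝔪 : ℝ) := by
      exact_mod_cast Nat.one_le_iff_ne_zero.mpr (by rwa [ne_eq, Ideal.absNorm_eq_zero_iff])
    rw [hA]; nlinarith
  have ht7 : (1 : ℝ) ≤ |t| + 7 := by linarith [abs_nonneg t]
  have hB1 : 1 ≤ B := by
    rw [hB]
    have h1 : (1 : ℝ) ≤ Real.exp (2 * n) := Real.one_le_exp (by positivity)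
    have h2 : (1 : ℝ) ≤ (|t| + 7) ^ n := one_le_pow₀ ht7
    calc (1 : ℝ) = 1 * 1 * 1 := by ring
      _ ≤ _ := by gcongr
  have hfc : Real.exp (-(n : ℝ)) ≤ ‖L c‖ := exp_neg_finrank_le_norm_continuation_two_add h𝔪 hψ hLs t
  have hc0 : L c ≠ 0 := fun h ↦ by
    rw [h, norm_zero] at hfc; exact absurd hfc (not_le.mpr (Real.exp_pos _))
  have h1 : 0 < |r| := by rwa [abs_of_pos hr]
  have h2 : |r| < |(2 : ℝ)| := by rw [abs_of_pos hr, abs_of_pos two_pos]; exact hr'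
  have h3 : AnalyticOnNhd ℂ L (closedBall c |(2 : ℝ)|) :=
    (hL.differentiableOn.analyticOnNhd isOpen_univ).mono (Set.subset_univ _)
  have h4 : ∀ z ∈ sphere c |(2 : ℝ)|, ‖L z‖ ≤ B := by
    intro z hz
    rw [abs_of_pos two_pos] at hz
    exact hL₀b t z (sphere_subset_closedBall hz)
  have hJ := AnalyticOnNhd.sum_divisor_le h1 h2 hB1 h3 hc0 h4
  rw [abs_of_pos hr] at hJ
  have hcast : ((∑ᶠ u, divisor L (closedBall c r) u : ℤ) : ℝ) = ∑ᶠ u, (divisor L (closedBall c r) u : ℝ) :=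
    map_finsum (Int.castRingHom ℝ) ((divisor L (closedBall c r)).finiteSupport (isCompact_closedBall _ _))
  rw [← hcast]
  -- `log (B / |L c|) ≤ log A + 2n + n log(|t|+7) + n`
  have hlog : Real.log (B / ‖L c‖) ≤ Real.log A + 3 * n + n * Real.log (|t| + 7) := by
    have hfpos : 0 < ‖L c‖ := (Real.exp_pos _).trans_le hfc
    rw [Real.log_div (by positivity) hfpos.ne', hB, Real.log_mul (by positivity) (by positivity),
      Real.log_mul (by positivity) (by positivity), Real.log_exp, Real.log_pow]
    have hlogf : -(n : ℝ) ≤ Real.log ‖L c‖ := by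
      rw [← Real.log_exp (-(n : ℝ))]; exact Real.log_le_log (Real.exp_pos _) hfc
    linarith
  refine hJ.trans (div_le_div_of_nonneg_right hlog (Real.log_nonneg ?_))
  rw [le_div_iff₀ hr]; linarith

/-- The Jensen count of the disc `|s − (2 + it)| ≤ 7/4`, as a sum over the support of the divisor: at most
`8 (log(|d_K|𝔑𝔪) + 3n_K + n_K log(|t|+7))` zeros with multiplicity (`log(8/7) ≥ 1/8`).
[cite: ThornerZaman2019, Lemma 2.5] -/
theorem sum_divisor_continuation_le (hψ : IsRayClassCharacter 𝔪 ψ) (hprim : IsPrimitive 𝔪 ψ)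
    (hp : IsSignType 𝔪 ψ p) (h𝔪 : 𝔪 ≠ ⊥)
    (hnt : ∃ v : HeightOneSpectrum (𝓞 K), ¬ 𝔪 ≤ v.asIdeal ∧ ψ v ≠ 1)
    {L : ℂ → ℂ} (hL : Differentiable ℂ L) (hLs : ∀ s : ℂ, 1 < s.re → L s = rayClassLSeries 𝔪 ψ s)
    (t : ℝ) :
    ∑ u ∈ ((divisor L (closedBall (2 + t * I) (7 / 4))).finiteSupport (isCompact_closedBall _ _)).toFinset,
      (divisor L (closedBall (2 + t * I) (7 / 4)) u : ℝ) ≤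
        8 * (Real.log (|(discr K : ℝ)| * (Ideal.absNorm 𝔪 : ℝ)) + 3 * Module.finrank ℚ K +
          Module.finrank ℚ K * Real.log (|t| + 7)) := by
  set D := divisor L (closedBall (2 + t * I) (7 / 4)) with hD
  have hfin : (Function.support D).Finite := D.finiteSupport (isCompact_closedBall _ _)
  have hsum : ∑ u ∈ hfin.toFinset, (D u : ℝ) = ∑ᶠ u, (D u : ℝ) := by
    rw [finsum_eq_sum_of_support_subset (fun u => (D u : ℝ)) (s := hfin.toFinset) ?_]
    intro u hu
    simp only [Function.mem_support, ne_eq, Int.cast_eq_zero] at hu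
    simpa using hu
  rw [hsum]
  have hJ := finsum_divisor_continuation_le hψ hprim hp h𝔪 hnt hL hLs t (r := 7 / 4) (by norm_num) (by norm_num)
  refine hJ.trans ?_
  have hlog : 1 / 8 ≤ Real.log (2 / (7 / 4)) := by
    have := Real.one_sub_inv_le_log_of_pos (x := 2 / (7 / 4)) (by norm_num)
    norm_num at this ⊢
    linarith
  -- the bound `M ≥ 0`
  have hA1 : 1 ≤ |(discr K : ℝ)| * (Ideal.absNorm 𝔪 : ℝ) := by
    have h1 : (1 : ℝ) ≤ |(discr K : ℝ)| := by
      have := Int.one_le_abs (discr_ne_zero K)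
      rw [← Int.cast_abs]; exact_mod_cast this
    have h2 : (1 : ℝ) ≤ (Ideal.absNorm 𝔪 : ℝ) := by
      exact_mod_cast Nat.one_le_iff_ne_zero.mpr (by rwa [ne_eq, Ideal.absNorm_eq_zero_iff])
    nlinarith
  have hM : 0 ≤ Real.log (|(discr K : ℝ)| * (Ideal.absNorm 𝔪 : ℝ)) + 3 * Module.finrank ℚ K +
      Module.finrank ℚ K * Real.log (|t| + 7) := by
    have h1 := Real.log_nonneg hA1
    have h2 : 0 ≤ Real.log (|t| + 7) := Real.log_nonneg (by linarith [abs_nonneg t])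
    positivity
  rw [div_le_iff₀ (by linarith)]
  nlinarith

end Literature.NumberTheory.LFunctions
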